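import Literature.NumberTheory.GelbartRogawski1991.CMSplittingCharLocalMu
import Literature.NumberTheory.Automorphic.IdeleClassCharacterLocalFactors
import Literature.NumberTheory.Automorphic.IdeleClassCharacterHecke
import HarnessLib

/-!
# The local components `μ_v` ([Liu2021, Def. 4.11] «`μ = ⊗ μ_v`») SEPARATE the idèle class character: weak approximation

Topic `NumberTheory/GelbartRogawski1991`; namespace `Literature.NumberTheory.GelbartRogawski1991.UnitaryDualPair.LocalSplitting`
(that of `CMSplittingCharLocalMu`).  KERNEL ONLY: theorems; no definition, no record, no named fact, no `sorry`.

`CMSplittingCharLocalMu.lean` reads the local component at a finite place `v` of `L⁺` of a Hecke character `χ` of the CM field `L` as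
the character `localMu L χ v : (∏_{w ∣ v} L_w)^× → ℂ^×`, `x ↦ ∏_{w ∣ v} χ_w(x_w)` — the Step-2 character `μ_v` of [Liu2021, App. D §D.1]
at `(E, F) := (E_v, F_v)` for Liu's «`μ = ⊗ μ_v`» (Def. 4.11, l. 2086).  This file records the converse bookkeeping the GLOBAL separation
of `μ` needs ([Liu2021, Thm. 4.18 (2)] «mutually non-isomorphic», proved by «Statement (2) follows from Lemma D.1», l. 2270: Lemma D.1 (3)
gives `μ_v = μ'_v` at every finite place, hence `μ = μ'`):

* `localMu_piUnits_symm_mulSingle` (after a private coordinate computation) — on the unit `(1, …, u, …, 1)` (`u ∈ L_w^×` at one `w ∣ v`), `μ_v` is `χ(⟨u⟩_w)` (`localUnits w u`);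
* `eqOn_localUnits_of_localMu_eq` — `localMu L χ v = localMu L χ' v` ⟹ `χ(⟨u⟩_w) = χ'(⟨u⟩_w)` for all `w ∣ v`, `u ∈ L_w^×`;
* **`eq_of_forall_localMu_toHeckeCharacter_eq`** — for unitary idèle class characters `μ, μ' : C_L → S¹`: if
  `localMu L (toHeckeCharacter L μ) v = localMu L (toHeckeCharacter L μ') v` at EVERY finite place `v` of `L⁺`, then `μ = μ'`
  (✔ `IdeleClassGroup.eq_of_eqOn_localUnits`: an idèle class character is determined by its local components at the finite places —
  [CasselsFrohlichANT1967, Ch. VII §8]; [TateThesis1967, Lemma 3.2.1]).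

Cell pub-hodgecm2 (COR-CM), Δ2 BRIDGE cite leg `hμsep`; seat prover-pub-hodgecm2-b10-g69-0.  HC_CM is NOT proved; nothing of [Liu2021] is asserted.

## References
* [Liu2021] Y. Liu, Camb. J. Math. 9 (2021) = arXiv:2102.11518: Def. 4.11 (l. 2086), Thm. 4.18 (2) and its proof (l. 2241, 2270),
  App. D §D.1 Step 2 (l. 5219).
* [CasselsFrohlichANT1967] Ch. VII §8 (proof of 8.7).  [TateThesis1967] Ch. XV §3.2 Lemma 3.2.1.
-/

set_option autoImplicit false

noncomputable section

open scoped Classical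

open NumberField IsDedekindDomain
open Literature.NumberTheory.Automorphic Literature.NumberTheory.Automorphic.UnitaryGroup
open Literature.NumberTheory.Automorphic.IdeleClassGroup (toHeckeCharacter coe_toHeckeCharacter_apply)
open Literature.NumberTheory.GaloisRepresentations

namespace Literature.NumberTheory.GelbartRogawski1991.UnitaryDualPair.LocalSplitting

section CM

variable (L : Type) [Field L] [NumberField L]

local notation3 "L⁺" => (↥(maximalRealSubfield L))

/-- the `w'`-coordinate of the unit `(1, …, u, …, 1)` of `E_v^× = (∏_{w ∣ v} L_w)^×` supported at `w` (plumbing). [folklore] -/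
private theorem units_map_eval_piUnits_symm_mulSingle (v : HeightOneSpectrum (𝓞 L⁺)) (w w' : PlacesOver L v)
    (u : (w.1.adicCompletion L)ˣ) :
    Units.map (Pi.evalMonoidHom (fun w : PlacesOver L v => w.1.adicCompletion L) w')
        (MulEquiv.piUnits.symm (Pi.mulSingle (M := fun w : PlacesOver L v => (w.1.adicCompletion L)ˣ) w u) : (LocalRing L v)ˣ) =
      Pi.mulSingle (M := fun w : PlacesOver L v => (w.1.adicCompletion L)ˣ) w u w' :=
  Units.ext rfl

/-- **`μ_v` on a unit supported at one place `w ∣ v` is the local component `χ_w`**: `localMu L χ v (1, …, u, …, 1) = χ(⟨u⟩_w)`.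
[cite: Liu2021, Def. 4.11 (l. 2086) and App. D §D.1 Step 2 (l. 5219)] -/
theorem localMu_piUnits_symm_mulSingle (χ : HeckeCharacter L) (v : HeightOneSpectrum (𝓞 L⁺)) (w : PlacesOver L v)
    (u : (w.1.adicCompletion L)ˣ) :
    localMu L χ v (MulEquiv.piUnits.symm (Pi.mulSingle (M := fun w : PlacesOver L v => (w.1.adicCompletion L)ˣ) w u) : (LocalRing L v)ˣ) =
      χ (localUnits w.1 u) := by
  classical
  rw [localMu_apply, Finset.prod_eq_single w]
  · rw [units_map_eval_piUnits_symm_mulSingle, Pi.mulSingle_eq_same]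
  · intro w' _ hw'
    rw [units_map_eval_piUnits_symm_mulSingle, Pi.mulSingle_eq_of_ne hw', map_one, map_one]
  · intro h
    exact absurd (Finset.mem_univ w) h

/-- **Equal `μ_v` ⟹ equal local components at every `w ∣ v`.** [cite: Liu2021, Def. 4.11 (l. 2086) and App. D §D.1 Step 2 (l. 5219)] -/
theorem eqOn_localUnits_of_localMu_eq {χ χ' : HeckeCharacter L} {v : HeightOneSpectrum (𝓞 L⁺)}
    (h : localMu L χ v = localMu L χ' v) (w : PlacesOver L v) (u : (w.1.adicCompletion L)ˣ) :
    χ (localUnits w.1 u) = χ' (localUnits w.1 u) := by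
  rw [← localMu_piUnits_symm_mulSingle L χ v w u, ← localMu_piUnits_symm_mulSingle L χ' v w u, h]

/-- **THE GLOBAL SEPARATION OF `μ` FROM ITS LOCAL COMPONENTS** ([Liu2021, Thm. 4.18 (2)]'s «follows from Lemma D.1», l. 2270, global half):
two unitary idèle class characters `μ, μ' : C_L → S¹` whose Step-2 local characters `μ_v = localMu L (toHeckeCharacter L μ) v` agree at
EVERY finite place `v` of `L⁺` are EQUAL — every finite place `w` of `L` lies over `w ∩ L⁺`, so the two characters agree on all local
idèles `⟨u⟩_w` and ✔ `IdeleClassGroup.eq_of_eqOn_localUnits` (weak approximation) applies.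
[cite: Liu2021, Def. 4.11 (l. 2086), Thm. 4.18 (2) with proof l. 2270; CasselsFrohlichANT1967, Ch. VII §8 (proof of 8.7); TateThesis1967, Ch. XV §3.2 Lemma 3.2.1] -/
theorem eq_of_forall_localMu_toHeckeCharacter_eq (μ μ' : IdeleClassGroup L →ₜ* Circle)
    (h : ∀ v : HeightOneSpectrum (𝓞 L⁺), localMu L (toHeckeCharacter L μ) v = localMu L (toHeckeCharacter L μ') v) : μ = μ' := by
  refine IdeleClassGroup.eq_of_eqOn_localUnits L μ μ' fun w u => ?_
  have hw := eqOn_localUnits_of_localMu_eq L (h (w.under (𝓞 L⁺))) ⟨w, rfl⟩ u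
  have hw' := congrArg (fun z : ℂˣ => (z : ℂ)) hw
  simp only [coe_toHeckeCharacter_apply] at hw'
  rw [IdeleClassGroup.mk_apply]
  exact Circle.ext hw'

end CM

end Literature.NumberTheory.GelbartRogawski1991.UnitaryDualPair.LocalSplitting

end
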